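import Summits.ABC.ABC.Theorems.DefiniteXiDefiniteRTControlPrimeOfTakahashi
import Literature.NumberTheory.EllipticCurves.TakahashiDegreeFormulaCoprimeProofs
import HarnessLib

/-!
# Stub-ideation k3 (gen 18) companion for `stub_takahashi` of crux `DefiniteRTControlPrime`
(stmt-ABC-11338, route DefiniteXi).  Elaboration sanity only; sorries mark stubs / exhibit lemmas.

§A  the ONE-stub line (also published stand-alone as `Lines/Takahashi.lean`, candidate).
§B  exhibit lemma for the FAMILY-3 extreme table (class number two ⇒ `ξ = w₁ + w₂`).
-/

set_option linter.dupNamespace false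

namespace Summit.ABC.ABC.Cruxes.DefiniteRTControlPrime.StubIdeas3g18

open Literature.NumberTheory.EllipticCurves Literature.NumberTheory.EllipticCurves.ModularForms
open Literature.NumberTheory.Automorphic

/-! ## §A — one-stub line over the landed `definiteRTControlPrime_of_takahashi` -/

/-- stub (FACT LEAF): Takahashi 2001, Thm. 2.3, coprime form. [cite: Takahashi2001, Thm. 2.3 (p. 79)] -/
theorem stub_takahashi : takahashi2001_thm_2_3_of_coprime := by
  sorry

/-- Composition, no sorry: stub statement → crux, by name. -/
theorem DefiniteRTControlPrime_of :
    takahashi2001_thm_2_3_of_coprime →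
      Summit.ABC.ABC.Theses.DefiniteXi.DefiniteRTControlPrime :=
  Summit.ABC.ABC.Theorems.DefiniteRTControlPrime.definiteRTControlPrime_of_takahashi

/-- The exact instance of the stub the landed closer consumes (one-sided, at a conductor-minimal
pivot `(W⋆, P⋆)` of type `(M, q)`, `gcd(M, q) = 1`): nothing more of Thm. 2.3 is load-bearing. -/
theorem touchpoint (hT : takahashi2001_thm_2_3_of_coprime) (W : WeierstrassCurve ℚ) [W.IsElliptic]
    (M r : ℕ) [NeZero (M * r)] (hr : r.Prime) (hcop : M.Coprime r)
    (hN : W.conductorNorm ℤ = M * r) (P : ModularParametrizationData W (M * r))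
    (hmin : ∀ (W' : WeierstrassCurve ℚ) [W'.IsElliptic], W'.conductorNorm ℤ = M * r →
      ∀ P' : ModularParametrizationData W' (M * r), P'.f = P.f → P.modularDegree ≤ P'.modularDegree) :
    P.modularDegree ≤
      brandtXi M r (fun n => W.LFunction n) * (W.minimalDiscriminantNorm ℤ).factorization r :=
  takahashi2001_thm_2_3_of_coprime.modularDegree_le_brandtXi_mul hT W M r hr hcop hN P hmin

/-! ## §B — exhibit lemma: class number two -/

/-- **H18.3 (S, exhibit-grade, not load-bearing).**  If the Eichler order of a Brandt setup of type
`(N⁺, N⁻)` has class number two and the eigen-lattice of `λ` is a line `ℤ g` inside the degree-zero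
part (`Σ g = 0`, i.e. `λ` is cuspidal), then `ξ_S(λ) = w₁ + w₂`.  Proof sketch: `g = (x, -x)`,
`x ≠ 0`; the eigen-lattice is saturated (`Brandt.mem_eigenLattice_of_smul_mem`), so `(1, -1) ∈ ℤ g`
and `|x| = 1`; conclude with `Brandt.xiOfOrder_eq` + `Brandt.xi_eq_sum`.  Used to certify the eleven
genus-one types `(M, r)` of the extreme table (`ξ = w₁ + w₂ = ord_r Δ_min` of the optimal curve),
with the weights read off Eichler's mass formula `1/w₁ + 1/w₂ = φ(N⁻)ψ(N⁺)/12`.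
[cite: Voight, Quaternion Algebras, Thm. 25.3.18] [cite: PollackWeston2011, §2.1] -/
theorem xi_eq_sum_weight_of_card_two {Nplus Nminus : ℕ} (S : Brandt.XiSetup Nplus Nminus)
    [Fintype (Brandt.ClassSet S.O)] (hcard : Fintype.card (Brandt.ClassSet S.O) = 2)
    (lam : ℕ → ℤ) {g : Brandt.ClassSet S.O → ℤ} (hg : g ≠ 0)
    (hL : Brandt.eigenLattice (Nplus * Nminus) (Brandt.matrix S.O) lam = ℤ ∙ g)
    (hsum : ∑ c, g c = 0) :
    S.xi lam = ∑ c, Brandt.weight S.O c := by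
  sorry

end Summit.ABC.ABC.Cruxes.DefiniteRTControlPrime.StubIdeas3g18
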